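import Summits.QuantumFields.YangMills.Theorems.LangevinControlUVFemtoCurvatureTwoPointStrictRPOddDefs
import Summits.QuantumFields.YangMills.Theorems.LangevinControlUVFemtoCurvatureTwoPointStrictRPSiteTransfer

/-!
# Crux `FemtoCurvatureTwoPoint` (stmt-QuantumFields-9363, route `LangevinControlUV`):
# strict positivity of the axis covariance — the top transfer step of the odd torus is a slice kernel

Helper for the registered sub-goal `stub_axisPositive` (`--supports stmt-QuantumFields-9363`), odd
torus `L = 2m + 1`. Geometry of the top transfer step (links of top plaquettes; the other odd-positive
plaquettes only read rest links `1 ≤ t ≤ m`, not top temporal; links off `P ∪ C` have no end in the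
middle slice, so gauge transformations supported on the middle slice commute with splicing `P ∪ C`),
and the identity `exp(β · topAction (topSplice V W Y)) = K_{E_mid}((shiftUp V)^{γ_Y}, W)`
(`exp_topAction_topSplice`: each top plaquette is one Gram factor, unitarity `ρ(g⁻¹) = ρ(g)ᴴ`),
together with the **kernel flip** `K_E(B^{γ}, W) = K_E(B, W^{γ⁻¹})` (`sliceKernel_gaugeTransform_left`,
unitary invariance of the pairing) which moves the gauge transformation from the boundary side to
the slice side.
-/

set_option autoImplicit false

noncomputable section

namespace Summit.QuantumFields.YangMills.Theorems.FemtoCurvatureTwoPoint.StrictRP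

open MeasureTheory Finset
open scoped Matrix ComplexConjugate
open Literature.MathematicalPhysics.QuantumFieldTheory

/-! ### Geometry of the top transfer step -/

section OddGeometry

variable {d L : ℕ} [NeZero d] [NeZero L]

/-- Links read by the rest of the odd-positive action: based at times `1 ≤ t ≤ L/2` and not a top
temporal link. -/
def IsRestEdge (e : Edge d L) : Prop :=
  1 ≤ (e.1 0).val ∧ (e.1 0).val ≤ L / 2 ∧ ¬ (e.2 = 0 ∧ (e.1 0).val = L / 2)

omit [NeZero L] in
/-- Rest links are odd-positive. [folklore] -/
theorem isOPosEdge_of_isRestEdge {e : Edge d L} (he : IsRestEdge e) : WilsonOddRP.IsOPosEdge e :=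
  ⟨he.1, he.2.1⟩

/-- Membership in the middle-slice links. -/
@[simp] theorem mem_midEdges {e : Edge d L} :
    e ∈ (midEdges : Finset (Edge d L)) ↔ e.2 ≠ 0 ∧ (e.1 0).val = L / 2 := by
  simp [midEdges]

/-- Membership in the top temporal links. -/
@[simp] theorem mem_topEdges {e : Edge d L} :
    e ∈ (topEdges : Finset (Edge d L)) ↔ e.2 = 0 ∧ (e.1 0).val = L / 2 := by
  simp [topEdges]

/-- Rest links are not top temporal links. [folklore] -/
theorem not_mem_topEdges_of_isRestEdge {e : Edge d L} (he : IsRestEdge e) :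
    e ∉ (topEdges : Finset (Edge d L)) := fun h => he.2.2 (mem_topEdges.1 h)

variable [Fact (1 < L)]

/-- Time of `x + e₀` when `x` is in the middle slice (`L ≥ 3`). [folklore] -/
theorem val_shift_zero_of_val_eq_half (hL3 : 3 ≤ L) {x : Site d L} (hx : (x 0).val = L / 2) :
    ((x.shift 0) 0).val = L / 2 + 1 := by
  rw [WilsonRP.val_shift_self, hx, if_neg (by omega)]

/-- Middle-slice links are odd-positive. [folklore] -/
theorem isOPosEdge_of_mem_midEdges {e : Edge d L} (he : e ∈ (midEdges : Finset (Edge d L))) :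
    WilsonOddRP.IsOPosEdge e := by
  rw [mem_midEdges] at he
  have : 1 < L := Fact.out
  exact ⟨by rw [he.2]; omega, by rw [he.2]⟩

/-- Top temporal links are odd-positive. [folklore] -/
theorem isOPosEdge_of_mem_topEdges {e : Edge d L} (he : e ∈ (topEdges : Finset (Edge d L))) :
    WilsonOddRP.IsOPosEdge e := by
  rw [mem_topEdges] at he
  have : 1 < L := Fact.out
  exact ⟨by rw [he.2]; omega, by rw [he.2]⟩

omit [NeZero L] in
/-- Top plaquettes are odd-positive. [folklore] -/
theorem isOPosPlaq_of_isTopPlaq {p : Plaquette d L} (hp : IsTopPlaq p) : WilsonOddRP.IsOPosPlaq p := by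
  have : 1 < L := Fact.out
  exact ⟨by rw [hp.2]; omega, le_of_eq hp.2⟩

/-- The four links of a top plaquette: temporal `L/2 → L/2+1`, shared spatial at `t = L/2 + 1`,
temporal `L/2 → L/2+1`, middle spatial at `t = L/2` (`L ≥ 3`). [folklore] -/
theorem edges_of_isTopPlaq (hL3 : 3 ≤ L) {p : Plaquette d L} (hp : IsTopPlaq p) :
    (p.1, p.2.1.1) ∈ (topEdges : Finset (Edge d L)) ∧
      (p.1.shift p.2.1.1, p.2.1.2) ∈ (WilsonOddRP.oSharedEdges : Finset (Edge d L)) ∧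
      (p.1.shift p.2.1.2, p.2.1.1) ∈ (topEdges : Finset (Edge d L)) ∧
      (p.1, p.2.1.2) ∈ (midEdges : Finset (Edge d L)) := by
  have hj : p.2.1.2 ≠ 0 := WilsonRP.plaq_snd_ne_zero p
  obtain ⟨hi, ht⟩ := hp
  refine ⟨?_, ?_, ?_, ?_⟩
  · rw [mem_topEdges]; exact ⟨hi, ht⟩
  · rw [WilsonOddRP.mem_oSharedEdges, hi]; exact ⟨hj, val_shift_zero_of_val_eq_half hL3 ht⟩
  · rw [mem_topEdges, WilsonRP.val_shift_of_ne _ hj.symm]; exact ⟨hi, ht⟩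
  · rw [mem_midEdges]; exact ⟨hj, ht⟩

/-- An odd-positive plaquette which is not a top plaquette only has rest links. [folklore] -/
theorem edges_of_rest {p : Plaquette d L} (hp : WilsonOddRP.IsOPosPlaq p) (hnt : ¬ IsTopPlaq p) :
    IsRestEdge (p.1, p.2.1.1) ∧ IsRestEdge (p.1.shift p.2.1.1, p.2.1.2) ∧
      IsRestEdge (p.1.shift p.2.1.2, p.2.1.1) ∧ IsRestEdge (p.1, p.2.1.2) := by
  have hj : p.2.1.2 ≠ 0 := WilsonRP.plaq_snd_ne_zero p
  obtain ⟨h1, h2⟩ := hp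
  unfold IsTopPlaq at hnt
  unfold IsRestEdge
  by_cases hi : p.2.1.1 = 0
  · have ht : (p.1 0).val ≠ L / 2 := fun h => hnt ⟨hi, h⟩
    have hlt : (p.1 0).val < L / 2 := lt_of_le_of_ne h2 ht
    refine ⟨⟨h1, h2, fun h => ht h.2⟩, ?_, ?_, ⟨h1, h2, fun h => hj h.1⟩⟩
    · rw [hi, WilsonRP.val_shift_self]
      refine ⟨?_, ?_, fun h => hj h.1⟩ <;> split_ifs <;> omega
    · rw [WilsonRP.val_shift_of_ne _ hj.symm]
      exact ⟨h1, h2, fun h => ht h.2⟩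
  · refine ⟨⟨h1, h2, fun h => hi h.1⟩, ?_, ?_, ⟨h1, h2, fun h => hj h.1⟩⟩
    · rw [WilsonRP.val_shift_of_ne _ (Ne.symm hi)]; exact ⟨h1, h2, fun h => hj h.1⟩
    · rw [WilsonRP.val_shift_of_ne _ hj.symm]; exact ⟨h1, h2, fun h => hi h.1⟩

/-- A link off `P ∪ C` has neither end in the middle slice. [folklore] -/
theorem val_ne_half_of_not_mem {e : Edge d L}
    (he : e ∉ (WilsonOddRP.oPosEdges ∪ WilsonOddRP.lowerEdges : Finset (Edge d L))) :
    (e.1 0).val ≠ L / 2 ∧ ((e.1.shift e.2) 0).val ≠ L / 2 := by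
  rw [Finset.mem_union, WilsonOddRP.mem_oPosEdges, WilsonOddRP.mem_lowerEdges] at he
  have h1L : 1 < L := Fact.out
  have hm1 : 1 ≤ L / 2 := by omega
  have hP : ¬ (1 ≤ (e.1 0).val ∧ (e.1 0).val ≤ L / 2) := fun h => he (Or.inl h)
  have hC : ¬ (e.2 = 0 ∧ (e.1 0).val = 0) := fun h => he (Or.inr h)
  refine ⟨fun h => hP ⟨by rw [h]; exact hm1, le_of_eq h⟩, fun h => ?_⟩
  by_cases hi : e.2 = 0
  · rw [hi, WilsonRP.val_shift_self] at h
    split_ifs at h with htop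
    · omega
    · -- `t + 1 = L/2`: then `t = L/2 - 1` is positive or a crossing time
      by_cases ht0 : (e.1 0).val = 0
      · exact hC ⟨hi, ht0⟩
      · exact hP ⟨by omega, by omega⟩
  · rw [WilsonRP.val_shift_of_ne _ (Ne.symm hi)] at h
    exact hP ⟨by rw [h]; exact hm1, le_of_eq h⟩

end OddGeometry

/-! ### Gauge transformations supported on the middle slice -/

section OddGauge

variable {d L N : ℕ} [NeZero d] [NeZero L] [Fact (1 < L)] {G : Type*} [Group G]
  (ρ : G →* Matrix (Fin N) (Fin N) ℂ)

omit [NeZero L] [Fact (1 < L)] in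
/-- `γ_Y = 1` off the middle slice. -/
theorem gaugeOfTop_of_ne (Y : GaugeConfig d L G) {x : Site d L} (hx : (x 0).val ≠ L / 2) :
    gaugeOfTop Y x = 1 := by
  simp [gaugeOfTop, hx]

omit [NeZero L] [Fact (1 < L)] in
/-- `γ_Y(x) = Y(x, 0)` on the middle slice. -/
theorem gaugeOfTop_of_eq (Y : GaugeConfig d L G) {x : Site d L} (hx : (x 0).val = L / 2) :
    gaugeOfTop Y x = Y (x, 0) := by
  simp [gaugeOfTop, hx]

/-- A gauge transformation supported on the middle slice only moves links of `P ∪ C`. [folklore] -/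
theorem gaugeTransform_apply_of_not_mem_odd {γ : Site d L → G}
    (hγ : ∀ x : Site d L, (x 0).val ≠ L / 2 → γ x = 1) (U : GaugeConfig d L G) {e : Edge d L}
    (he : e ∉ (WilsonOddRP.oPosEdges ∪ WilsonOddRP.lowerEdges : Finset (Edge d L))) :
    gaugeTransform γ U e = U e := by
  obtain ⟨h1, h2⟩ := val_ne_half_of_not_mem he
  simp only [gaugeTransform, hγ _ h1, hγ _ h2, one_mul, inv_one, mul_one]

/-- Splicing `P ∪ C` commutes with gauge transformations supported on the middle slice. [folklore] -/
theorem splice_gaugeTransform_odd {γ : Site d L → G}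
    (hγ : ∀ x : Site d L, (x 0).val ≠ L / 2 → γ x = 1) (V W : GaugeConfig d L G) :
    LatticeRP.splice (WilsonOddRP.oPosEdges ∪ WilsonOddRP.lowerEdges) (V, gaugeTransform γ W) =
      gaugeTransform γ (LatticeRP.splice (WilsonOddRP.oPosEdges ∪ WilsonOddRP.lowerEdges) (V, W)) := by
  funext e
  by_cases he : e ∈ (WilsonOddRP.oPosEdges ∪ WilsonOddRP.lowerEdges : Finset (Edge d L))
  · simp only [gaugeTransform, LatticeRP.splice_apply, if_pos he]
  · rw [gaugeTransform_apply_of_not_mem_odd hγ _ he]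
    simp only [LatticeRP.splice_apply, if_neg he]

end OddGauge

/-! ### The top transfer step as a slice kernel -/

section OddTransfer

variable {d L N : ℕ} [NeZero d] [NeZero L] [Fact (1 < L)] {G : Type*} [Group G]
  [TopologicalSpace G] [IsTopologicalGroup G] [CompactSpace G] [MeasurableSpace G] [BorelSpace G]
  (ρ : G →* Matrix (Fin N) (Fin N) ℂ)

omit [TopologicalSpace G] [IsTopologicalGroup G] [CompactSpace G] [MeasurableSpace G] [BorelSpace G] in
/-- `A_odd = (top transfer step) + (rest)`. [folklore] -/
theorem oPosAction_eq_add (U : GaugeConfig d L G) :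
    WilsonOddRP.oPosAction ρ U = topAction ρ U + restOddAction ρ U := by
  unfold WilsonOddRP.oPosAction topAction restOddAction
  rw [← Finset.sum_filter_add_sum_filter_not (univ.filter WilsonOddRP.IsOPosPlaq) IsTopPlaq]
  congr 1
  refine Finset.sum_congr ?_ fun _ _ => rfl
  ext p
  simp only [Finset.mem_filter, Finset.mem_univ, true_and]
  exact ⟨fun h => h.2, fun h => ⟨isOPosPlaq_of_isTopPlaq h, h⟩⟩

omit [Fact (1 < L)] [TopologicalSpace G] [IsTopologicalGroup G] [CompactSpace G] [MeasurableSpace G]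
  [BorelSpace G] in
/-- The rest of the odd action is gauge invariant. [folklore] -/
theorem restOddAction_gaugeTransform (g : Site d L → G) (U : GaugeConfig d L G) :
    restOddAction ρ (gaugeTransform g U) = restOddAction ρ U := by
  unfold restOddAction
  exact Finset.sum_congr rfl fun p _ => plaqRe_gaugeTransform ρ g U p

omit [TopologicalSpace G] [IsTopologicalGroup G] [CompactSpace G] [MeasurableSpace G] [BorelSpace G] in
/-- The rest of the odd action only reads rest links. [folklore] -/
theorem restOddAction_congr {U U' : GaugeConfig d L G}
    (h : ∀ e : Edge d L, IsRestEdge e → U e = U' e) : restOddAction ρ U = restOddAction ρ U' := by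
  unfold restOddAction
  refine Finset.sum_congr rfl fun p hp => ?_
  rw [Finset.mem_filter, Finset.mem_filter] at hp
  obtain ⟨t1, t2, t3, t4⟩ := edges_of_rest hp.1.2 hp.2
  unfold WilsonRP.plaqRe plaquetteHolonomy
  rw [h _ t1, h _ t2, h _ t3, h _ t4]

omit [TopologicalSpace G] [IsTopologicalGroup G] [CompactSpace G] [MeasurableSpace G] [BorelSpace G] in
/-- A spatial plaquette in the middle slice reads only links of `P`, hence only the second splice
component. [folklore] -/
theorem plaqRe_splice_odd_of_spatial {q : Plaquette d L} (hq : q.2.1.1 ≠ 0)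
    (ht : (q.1 0).val = L / 2) (V W : GaugeConfig d L G) :
    WilsonRP.plaqRe ρ (LatticeRP.splice (WilsonOddRP.oPosEdges ∪ WilsonOddRP.lowerEdges) (V, W)) q =
      WilsonRP.plaqRe ρ W q := by
  have hj : q.2.1.2 ≠ 0 := WilsonRP.plaq_snd_ne_zero q
  have h1L : 1 < L := Fact.out
  have hmem : ∀ e : Edge d L, (e.1 0).val = L / 2 →
      LatticeRP.splice (WilsonOddRP.oPosEdges ∪ WilsonOddRP.lowerEdges) (V, W) e = W e := fun e he => by
    have : e ∈ (WilsonOddRP.oPosEdges ∪ WilsonOddRP.lowerEdges : Finset (Edge d L)) := by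
      rw [Finset.mem_union, WilsonOddRP.mem_oPosEdges]
      exact Or.inl ⟨by rw [he]; omega, le_of_eq he⟩
    rw [LatticeRP.splice_apply, if_pos this]
  unfold WilsonRP.plaqRe plaquetteHolonomy
  rw [hmem _ ht, hmem (q.1.shift q.2.1.1, q.2.1.2) (by rw [WilsonRP.val_shift_of_ne _ (Ne.symm hq)]; exact ht),
    hmem (q.1.shift q.2.1.2, q.2.1.1) (by rw [WilsonRP.val_shift_of_ne _ hj.symm]; exact ht), hmem _ ht]

omit [TopologicalSpace G] [IsTopologicalGroup G] [CompactSpace G] [MeasurableSpace G] [BorelSpace G] in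
/-- **One top plaquette is one Gram factor**: for a top plaquette `p = (y; 0, i)`,
`Re tr ρ(U_p) = ⟪ρ((B^{γ_Y})(y, i)), ρ(W(y, i))⟫` on `topSplice V W Y`, `B = shiftUp V`
(`L` odd, `L ≥ 3`). [folklore] -/
theorem plaqRe_topSplice_of_isTopPlaq (hL3 : 3 ≤ L)
    (hunit : ∀ g, ρ g ∈ Matrix.unitaryGroup (Fin N) ℂ)
    (V W Y : GaugeConfig d L G) {p : Plaquette d L} (hp : IsTopPlaq p) :
    WilsonRP.plaqRe ρ (topSplice V W Y) p =
      pairing ρ (gaugeTransform (gaugeOfTop Y) (shiftUp V) (p.1, p.2.1.2)) (W (p.1, p.2.1.2)) := by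
  obtain ⟨he1, he2, he3, he4⟩ := edges_of_isTopPlaq hL3 hp
  have hi : p.2.1.1 = 0 := hp.1
  rw [hi] at he1 he2 he3
  have ht : (p.1 0).val = L / 2 := hp.2
  have hj : p.2.1.2 ≠ 0 := WilsonRP.plaq_snd_ne_zero p
  set PC : Finset (Edge d L) := WilsonOddRP.oPosEdges ∪ WilsonOddRP.lowerEdges with hPC
  have hP1 : (p.1, (0 : Fin d)) ∈ PC := Finset.mem_union.2
    (Or.inl (WilsonOddRP.mem_oPosEdges.2 (isOPosEdge_of_mem_topEdges he1)))
  have hP3 : (p.1.shift p.2.1.2, (0 : Fin d)) ∈ PC := Finset.mem_union.2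
    (Or.inl (WilsonOddRP.mem_oPosEdges.2 (isOPosEdge_of_mem_topEdges he3)))
  have hP4 : (p.1, p.2.1.2) ∈ PC := Finset.mem_union.2
    (Or.inl (WilsonOddRP.mem_oPosEdges.2 (isOPosEdge_of_mem_midEdges he4)))
  have hP2 : (p.1.shift 0, p.2.1.2) ∉ PC := by
    have hM := he2
    intro h
    rw [hPC, Finset.mem_union, WilsonOddRP.mem_oPosEdges, WilsonOddRP.mem_lowerEdges] at h
    rw [WilsonOddRP.mem_oSharedEdges] at hM
    rcases h with h | h
    · exact WilsonOddRP.not_isOPosEdge_of_isOSharedEdge hM h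
    · exact WilsonOddRP.not_isOSharedEdge_of_isLowerCross h hM
  have hT4 : (p.1, p.2.1.2) ∉ (topEdges : Finset (Edge d L)) := fun h => hj (mem_topEdges.1 h).1
  have v1 : topSplice V W Y (p.1, 0) = Y (p.1, 0) := by
    simp only [topSplice, ← hPC, LatticeRP.splice_apply, if_pos hP1, if_pos he1]
  have v2 : topSplice V W Y (p.1.shift 0, p.2.1.2) = V (p.1.shift 0, p.2.1.2) := by
    simp only [topSplice, ← hPC, LatticeRP.splice_apply, if_neg hP2]
  have v3 : topSplice V W Y (p.1.shift p.2.1.2, 0) = Y (p.1.shift p.2.1.2, 0) := by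
    simp only [topSplice, ← hPC, LatticeRP.splice_apply, if_pos hP3, if_pos he3]
  have v4 : topSplice V W Y (p.1, p.2.1.2) = W (p.1, p.2.1.2) := by
    simp only [topSplice, ← hPC, LatticeRP.splice_apply, if_pos hP4, if_neg hT4]
  have g1 : gaugeOfTop Y p.1 = Y (p.1, 0) := gaugeOfTop_of_eq Y ht
  have g2 : gaugeOfTop Y (p.1.shift p.2.1.2) = Y (p.1.shift p.2.1.2, 0) :=
    gaugeOfTop_of_eq Y (by rw [WilsonRP.val_shift_of_ne _ hj.symm]; exact ht)
  unfold WilsonRP.plaqRe plaquetteHolonomy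
  rw [hi, v1, v2, v3, v4, re_trace_mul_inv ρ hunit, pairing_comm]
  simp only [gaugeTransform, shiftUp, g1, g2]

omit [TopologicalSpace G] [IsTopologicalGroup G] [CompactSpace G] [MeasurableSpace G] [BorelSpace G] in
/-- **The top transfer step is the slice kernel of the middle slice**:
`exp(β · topAction (topSplice V W Y)) = K_{E_mid}((shiftUp V)^{γ_Y}, W)`. [folklore] -/
theorem exp_topAction_topSplice (hL3 : 3 ≤ L) (hunit : ∀ g, ρ g ∈ Matrix.unitaryGroup (Fin N) ℂ)
    (β : ℝ) (V W Y : GaugeConfig d L G) :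
    Real.exp (β * topAction ρ (topSplice V W Y)) =
      sliceKernel ρ β midEdges (gaugeTransform (gaugeOfTop Y) (shiftUp V)) W := by
  unfold sliceKernel topAction
  congr 2
  refine Finset.sum_bij (fun (p : Plaquette d L) _ => ((p.1, p.2.1.2) : Edge d L)) ?_ ?_ ?_ ?_
  · intro p hp
    have hp' : IsTopPlaq p := (Finset.mem_filter.1 hp).2
    exact (edges_of_isTopPlaq hL3 hp').2.2.2
  · intro p hp p' hp' h
    have hl : IsTopPlaq p := (Finset.mem_filter.1 hp).2
    have hl' : IsTopPlaq p' := (Finset.mem_filter.1 hp').2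
    obtain ⟨h1, h2⟩ := Prod.mk.inj h
    refine Prod.ext h1 (Subtype.ext (Prod.ext ?_ h2))
    rw [hl.1, hl'.1]
  · intro e he
    obtain ⟨hj, h1⟩ := mem_midEdges.1 he
    have hpos : (0 : Fin d) < e.2 := (Fin.pos_iff_ne_zero' e.2).2 hj
    refine ⟨((e.1, ⟨((0 : Fin d), e.2), hpos⟩) : Plaquette d L), ?_, rfl⟩
    rw [Finset.mem_filter]
    exact ⟨Finset.mem_univ _, rfl, h1⟩
  · intro p hp
    exact plaqRe_topSplice_of_isTopPlaq ρ hL3 hunit V W Y (Finset.mem_filter.1 hp).2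

omit [NeZero d] [NeZero L] [Fact (1 < L)] [TopologicalSpace G] [IsTopologicalGroup G] [CompactSpace G]
  [MeasurableSpace G] [BorelSpace G] in
/-- Unitary invariance of the pairing: `⟪ρ(a b c⁻¹), ρ(u)⟫ = ⟪ρ(b), ρ(a⁻¹ u c)⟫`. [folklore] -/
theorem pairing_conj (hunit : ∀ g, ρ g ∈ Matrix.unitaryGroup (Fin N) ℂ) (a b c u : G) :
    pairing ρ (a * b * c⁻¹) u = pairing ρ b (a⁻¹ * u * c) := by
  unfold pairing
  rw [map_mul, map_mul, map_mul, map_mul, Literature.MathematicalPhysics.QuantumLattice.unitaryRep_inv_eq_conjTranspose ρ hunit c,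
    Literature.MathematicalPhysics.QuantumLattice.unitaryRep_inv_eq_conjTranspose ρ hunit a, Matrix.conjTranspose_mul, Matrix.conjTranspose_mul,
    Matrix.conjTranspose_conjTranspose]
  rw [show ρ a * ρ b * (ρ c)ᴴ * (ρ u)ᴴ = ρ a * (ρ b * ((ρ c)ᴴ * (ρ u)ᴴ)) by noncomm_ring,
    ← Matrix.trace_mul_comm, show ρ b * ((ρ c)ᴴ * (ρ u)ᴴ) * ρ a = ρ b * ((ρ c)ᴴ * ((ρ u)ᴴ * ρ a)) by
      noncomm_ring]

omit [NeZero d] [NeZero L] [Fact (1 < L)] [TopologicalSpace G] [IsTopologicalGroup G] [CompactSpace G]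
  [MeasurableSpace G] [BorelSpace G] in
/-- **Kernel flip**: a gauge transformation of the boundary argument of the slice kernel is the
inverse gauge transformation of the slice argument. [folklore] -/
theorem sliceKernel_gaugeTransform_left (hunit : ∀ g, ρ g ∈ Matrix.unitaryGroup (Fin N) ℂ)
    (β : ℝ) (E : Finset (Edge d L)) (γ : Site d L → G) (B W : GaugeConfig d L G) :
    sliceKernel ρ β E (gaugeTransform γ B) W =
      sliceKernel ρ β E B (gaugeTransform (fun x => (γ x)⁻¹) W) := by
  unfold sliceKernel
  congr 2
  refine Finset.sum_congr rfl fun e _ => ?_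
  simp only [gaugeTransform, inv_inv]
  exact pairing_conj ρ hunit _ _ _ _

omit [TopologicalSpace G] [IsTopologicalGroup G] [CompactSpace G] [MeasurableSpace G] [BorelSpace G] in
/-- `shiftUp (topConfig A)` agrees with `A` on the middle-slice links (`L ≥ 3`). [folklore] -/
theorem shiftUp_topConfig (hL3 : 3 ≤ L) {A : GaugeConfig d L G} {e : Edge d L}
    (he : e ∈ (midEdges : Finset (Edge d L))) : shiftUp (topConfig A) e = A e := by
  obtain ⟨hj, h1⟩ := mem_midEdges.1 he
  have hmem : ((e.1.shift 0, e.2) : Edge d L) ∈ (WilsonOddRP.oSharedEdges : Finset (Edge d L)) := by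
    rw [WilsonOddRP.mem_oSharedEdges]
    exact ⟨hj, val_shift_zero_of_val_eq_half hL3 h1⟩
  simp only [shiftUp, topConfig, if_pos hmem]
  congr 1
  simp [Site.shift]

omit [Fact (1 < L)] [TopologicalSpace G] [IsTopologicalGroup G] [CompactSpace G] [MeasurableSpace G]
  [BorelSpace G] in
/-- Spliced configurations over any boundary agree with those over the trivial boundary at all
rest links (these lie in `P`). [folklore] -/
theorem splice_eq_of_isRestEdge [Fact (1 < L)] (V W : GaugeConfig d L G) {e : Edge d L} (he : IsRestEdge e) :
    LatticeRP.splice (WilsonOddRP.oPosEdges ∪ WilsonOddRP.lowerEdges) (V, W) e =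
      LatticeRP.splice (WilsonOddRP.oPosEdges ∪ WilsonOddRP.lowerEdges) ((fun _ => (1 : G)), W) e := by
  have : e ∈ (WilsonOddRP.oPosEdges ∪ WilsonOddRP.lowerEdges : Finset (Edge d L)) :=
    Finset.mem_union.2 (Or.inl (WilsonOddRP.mem_oPosEdges.2 (isOPosEdge_of_isRestEdge he)))
  simp only [LatticeRP.splice_apply, if_pos this]

end OddTransfer

/-- **Registered sub-goal `stub_topTransferKernel`** (`--supports stmt-QuantumFields-9363`): closed form of `exp_topAction_topSplice` — the top transfer step of the odd torus is the slice kernel of the middle slice after a gauge transformation of the boundary. [folklore] -/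
theorem stub_topTransferKernel : ∀ (d L N : ℕ) [NeZero d] [NeZero L] [Fact (1 < L)] (G : Type) [Group G] [TopologicalSpace G] [IsTopologicalGroup G] [CompactSpace G] [MeasurableSpace G] [BorelSpace G] (ρ : G →* Matrix (Fin N) (Fin N) ℂ), 3 ≤ L → (∀ g, ρ g ∈ Matrix.unitaryGroup (Fin N) ℂ) → ∀ (β : ℝ) (V W Y : Literature.MathematicalPhysics.QuantumFieldTheory.GaugeConfig d L G), Real.exp (β * Summit.QuantumFields.YangMills.Theorems.FemtoCurvatureTwoPoint.StrictRP.topAction ρ (Summit.QuantumFields.YangMills.Theorems.FemtoCurvatureTwoPoint.StrictRP.topSplice V W Y)) = Summit.QuantumFields.YangMills.Theorems.FemtoCurvatureTwoPoint.StrictRP.sliceKernel ρ β Summit.QuantumFields.YangMills.Theorems.FemtoCurvatureTwoPoint.StrictRP.midEdges (Literature.MathematicalPhysics.QuantumFieldTheory.gaugeTransform (Summit.QuantumFields.YangMills.Theorems.FemtoCurvatureTwoPoint.StrictRP.gaugeOfTop Y) (Summit.QuantumFields.YangMills.Theorems.FemtoCurvatureTwoPoint.StrictRP.shiftUp V)) W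 := by
  intro d L N _ _ _ G _ _ _ _ _ _ ρ hL3 hunit β V W Y
  exact exp_topAction_topSplice ρ hL3 hunit β V W Y

end Summit.QuantumFields.YangMills.Theorems.FemtoCurvatureTwoPoint.StrictRP

end
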